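import Summits.HodgeConjecture.CorCM.MultiFieldWeilOcticSlotsDegreeForm
import Summits.HodgeConjecture.CorCM.MultiFieldWeilSimpleFamilies
import HarnessLib

/-!
# MULTI-FIELD WEIL ENGINE — THE MENU WITH TYPES UP TO COMPLEX CONJUGATION: simple CM threefolds (no type hypothesis), CM fourfolds of `k`-signature
# `(1,3)`, `(2,2)` OR `(3,1)`, CM fivefolds of `k`-signature `(2,3)` OR `(3,2)` — the sextic + octic + decic headlines with the type normalisations removed

Cell `pub-hodgecm2` (COR-CM), seat b30 gen 38 (2026-08-25); count-neutral own lane MULTI-FIELD WEIL ENGINE (stem `MultiFieldWeil*`), sequel of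
`CorCM/MultiFieldWeilSexticsDecicsIntrinsic.lean` (Y3), `CorCM/MultiFieldWeilOcticSlotsHeadline.lean` (Z3) and gen 33's `CorCM/MultiFieldWeilSimpleFamilies.lean`
(`exists_realisations_of_forall_succ`: slotwise change of CM structure on the same varieties).  Theorems only; no definition, no named fact, no `sorry`.  HONEST FRAMING:
conditional ONLY on the two displayed Markman binders; `HC_CM` is NOT proved and not asserted.

THE POINT.  The headlines of Y3 ∕ Z3 fix the `k`-signature of each slot to `(p, n − p)` with `2p ≤ n` (`(1,2)`, `(1,3)`, `(2,2)`, `(2,3)`).  For a fixed VARIETY this is a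
normalisation, not a restriction: a structure `(Φ, ι, θ)` of `k`-signature `(n − p, p)` on `B` becomes one of signature `(p, n − p)` ON THE SAME `B` by transport along the
complex conjugation of `K` (Deligne 1982 §5 (b); the tree's `IsCMTypeRealisation.transport`, `SexticOcticWeil.card_filter_cmTypeMap_complexConj`) — §1
`exists_realisation_card_eq_of_or` (any degree: `p` or `n − p` members over `τ` ⟹ a structure with `p` members), §2 `exists_realisations_card_eq_of_or` (all slots at once, curve
slot unchanged).
The conclusions mention only the varieties, so (§3):
* **`hodgeConjectureFor_biproduct_comp_of_simpleThreefolds_weilFivefolds_of_isEmpty_ringHom`** — `E` + any number of SIMPLE CM threefolds over sextic CM fields `∋ k` (NO type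
  hypothesis: a simple threefold's type is not induced from `k`, gen 31's `card_filter_mem_eq_one_or_two_of_isSimple`) + any number of CM fivefolds of `k`-signature `(2,3)` OR
  `(3,2)` over decic CM fields `∋ k`, `Hom = ∅` within each degree ⟹ HC for every product of copies, mod Markman 4 + 6 (gen 33's `…simpleThreefolds_weilFivefolds_of_towers` with
  the towers replaced by `Hom = ∅` and nothing across degrees);
* **`hodgeConjectureFor_biproduct_comp_of_simpleThreefolds_fourfolds_weilFivefolds`** — the same plus any number of CM FOURFOLDS of `k`-signature `(1,3)`, `(2,2)` OR `(3,1)`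
  (i.e. any type not induced from `k`) over octic CM fields `∋ k` with `2`-transitive quartic part, under Z3's closure hypotheses; degree form `…_of_finrank_pair`.

[cite: Deligne1982HodgeCycles, §5 (b)] [cite: Shimura1998, §8.2 Prop. 26, §8.4, §18.2 Lemma (i)] [cite: Markman2025SurveySecant, Thm. 1.2] [cite: Markman2025SecantWeil, Thm 1.5.1]
[cite: Pohlmann1968, Thm 1] [cite: MoonenZarhin1995Duke, Thm. 2.4] [cite: Dodson1984, §1.1 Imprimitivity Theorem and §5.1.2 Theorem] [cite: DixonMortimer1996, §3.3, Thm. 3.3A]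
[cite: MumfordAV1970, §19]

## References
* [Deligne1982HodgeCycles] P. Deligne (notes by J. S. Milne), Hodge cycles on abelian varieties, LNM 900 (1982), §5 (b).  [Shimura1998] G. Shimura, *Abelian varieties with
  complex multiplication and modular functions*, §8.2 Prop. 26, §8.4, §18.2 Lemma (i).  [Markman2025SurveySecant] E. Markman, arXiv:2509.23403, Thm. 1.2.  [Markman2025SecantWeil]
  E. Markman, Cycles on abelian 2n-folds of Weil type from secant sheaves on abelian n-folds, Thm 1.5.1.  [Pohlmann1968] H. Pohlmann, Ann. of Math. 88 (1968), Thm 1.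
  [MoonenZarhin1995Duke] B. Moonen, Yu. Zarhin, Duke Math. J. 77 (1995), Thm. 2.4.  [Dodson1984] B. Dodson, Trans. AMS 283 (1984).  [DixonMortimer1996] J. D. Dixon,
  B. Mortimer, *Permutation Groups*, GTM 163, §3.3.  [MumfordAV1970] D. Mumford, *Abelian Varieties*, §19.
-/

noncomputable section

open CategoryTheory CategoryTheory.Limits NumberField IntermediateField

namespace Summit.HodgeConjecture.CorCM.MultiFieldWeil

open Finset
open Literature.AlgebraicGeometry Literature.AlgebraicGeometry.Motives Literature.AlgebraicGeometry.HodgeTheory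
open Literature.AlgebraicGeometry.ComplexMultiplication (IsCMTypeRealisation)
open Literature.AlgebraicTopology.SingularHomology
open Literature.NumberTheory.ComplexMultiplication
open Summit.HodgeConjecture.CorCM.Census.MultiFieldWeil

open scoped Classical

/-! ## §1 One slot: the conjugate structure on the same variety -/

section One

variable {k : Type} [Field k] [NumberField k]

/-- **TYPES UP TO COMPLEX CONJUGATION, ONE VARIETY, ANY DEGREE.**  `[k : ℚ] = 2`, `[K : ℚ] = 2 n` along `i : k → K`, `(B, ι, θ)` a structure of type `(K; Φ)` with `p` OR `n − p`
members of `Φ` over `τ` (`p ≤ n`).  Then `B` carries a structure of some type with exactly `p` members over `τ` (in the second case the transported structure along the complex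
conjugation of `K`; gen 31 ∕ 32's `exists_realisation_card_eq_one` ∕ `_two` at a free size). [cite: Deligne1982HodgeCycles, §5 (b)] [cite: Shimura1998, §18.2 Lemma (i)] -/
theorem exists_realisation_card_eq_of_or {K : Type} [Field K] [NumberField K] [IsCMField K] {nK : ℕ} (hK : Module.finrank ℚ K = 2 * nK) (h2 : Module.finrank ℚ k = 2)
    (i : k →+* K) {B : AbelianVariety ℂ} {Φ : CMType K} {ι : 𝓞 K →+* End B} {θ : K →+* Module.End ℂ (complexBetti B.X 1)}
    (hB : IsCMTypeRealisation Φ B ι θ) (τ : k →+* ℂ) {p : ℕ} (hp : p ≤ nK)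
    (hor : (Finset.univ.filter fun s : K →+* ℂ => s.comp i = τ ∧ s ∈ Φ.1).card = p ∨
      (Finset.univ.filter fun s : K →+* ℂ => s.comp i = τ ∧ s ∈ Φ.1).card = nK - p) :
    ∃ (Φ' : CMType K) (ι' : 𝓞 K →+* End B) (θ' : K →+* Module.End ℂ (complexBetti B.X 1)),
      IsCMTypeRealisation Φ' B ι' θ' ∧ (Finset.univ.filter fun s : K →+* ℂ => s.comp i = τ ∧ s ∈ Φ'.1).card = p := by
  rcases hor with h | h
  · exact ⟨Φ, ι, θ, hB, h⟩
  · refine ⟨_, _, _, hB.transport (IsCMField.complexConj K).toRingEquiv, ?_⟩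
    rw [SexticOcticWeil.card_filter_cmTypeMap_complexConj i τ Φ, SexticOcticWeil.card_filter_comp_eq_of_finrank i hK h2 τ, h]
    omega

end One

/-! ## §2 All slots at once -/

section Family

variable {I : Type} {r : ℕ} {Kf : I → Type} [∀ i, Field (Kf i)] [∀ i, NumberField (Kf i)] [∀ i, IsCMField (Kf i)]
  {i₀ : I} {is : Fin r → I} {n : Fin r → ℕ} {τ : Kf i₀ →+* ℂ}
  {A : Fin (r + 1) → AbelianVariety ℂ} {Φ : ∀ j : Fin (r + 1), CMType (Kf (mfSlots i₀ is j))}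
  {ι : ∀ j, 𝓞 (Kf (mfSlots i₀ is j)) →+* End (A j)}
  {θ : ∀ j, Kf (mfSlots i₀ is j) →+* Module.End ℂ (complexBetti (A j).X 1)}

/-- **TYPES UP TO COMPLEX CONJUGATION, ALL SLOTS.**  If slot `m` has `p_m` OR `n_m − p_m` members of its type over `τ` (`p_m ≤ n_m`), there are new structures `Φ', ι', θ'` on the
SAME family `A`, equal to the given one at the curve slot `0`, with exactly `p_m` members over `τ` at every slot. [cite: Deligne1982HodgeCycles, §5 (b)] [cite: Shimura1998, §18.2 Lemma (i)] -/
theorem exists_realisations_card_eq_of_or (h2 : Module.finrank ℚ (Kf i₀) = 2) (hdeg : ∀ m : Fin r, Module.finrank ℚ (Kf (is m)) = 2 * n m)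
    (im : ∀ m : Fin r, Kf i₀ →+* Kf (is m)) (hA : ∀ j, IsCMTypeRealisation (Φ j) (A j) (ι j) (θ j)) (p : Fin r → ℕ) (hpn : ∀ m, p m ≤ n m)
    (hor : ∀ m : Fin r, (Finset.univ.filter fun s : Kf (is m) →+* ℂ => s.comp (im m) = τ ∧ s ∈ (Φ m.succ).1).card = p m ∨
      (Finset.univ.filter fun s : Kf (is m) →+* ℂ => s.comp (im m) = τ ∧ s ∈ (Φ m.succ).1).card = n m - p m) :
    ∃ (Φ' : ∀ j : Fin (r + 1), CMType (Kf (mfSlots i₀ is j))) (ι' : ∀ j, 𝓞 (Kf (mfSlots i₀ is j)) →+* End (A j))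
      (θ' : ∀ j, Kf (mfSlots i₀ is j) →+* Module.End ℂ (complexBetti (A j).X 1)),
      (∀ j, IsCMTypeRealisation (Φ' j) (A j) (ι' j) (θ' j)) ∧ Φ' 0 = Φ 0 ∧
        ∀ m : Fin r, (Finset.univ.filter fun s : Kf (is m) →+* ℂ => s.comp (im m) = τ ∧ s ∈ (Φ' m.succ).1).card = p m :=
  exists_realisations_of_forall_succ hA
    (fun m Φ' => (Finset.univ.filter fun s : Kf (is m) →+* ℂ => s.comp (im m) = τ ∧ s ∈ Φ'.1).card = p m)
    fun m => exists_realisation_card_eq_of_or (hdeg m) h2 (im m) (hA m.succ) τ (hpn m) (hor m)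

end Family

/-! ## §3 The headlines with the type normalisations removed -/

section Headline

variable {I : Type} {r : ℕ} {Kf : I → Type} [∀ i, Field (Kf i)] [∀ i, NumberField (Kf i)] [∀ i, IsCMField (Kf i)]
  {i₀ : I} {is : Fin r → I} {τ : Kf i₀ →+* ℂ}
  {A : Fin (r + 1) → AbelianVariety ℂ} {Φ : ∀ j : Fin (r + 1), CMType (Kf (mfSlots i₀ is j))}
  {ι : ∀ j, 𝓞 (Kf (mfSlots i₀ is j)) →+* End (A j)}
  {θ : ∀ j, Kf (mfSlots i₀ is j) →+* Module.End ℂ (complexBetti (A j).X 1)}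

/-- **SIMPLE CM THREEFOLDS AND WEIL-TYPE CM FIVEFOLDS OVER ONE IMAGINARY QUADRATIC FIELD, `Hom = ∅` WITHIN EACH DEGREE — GIVEN ONLY MARKMAN'S TWO THEOREMS.**  `k = Kf i₀`
imaginary quadratic, `E = A 0 ⊨ (k; {τ})`; `B_m = A (m+1) ⊨ (K_m; Φ (m+1))` over CM fields `K_m ⊇ i_m(k)` with `[K_m : k] = n_m ∈ {3, 5}`: for `n_m = 3` the threefold `B_m` is SIMPLE
(no hypothesis on its type), for `n_m = 5` the type has `2` OR `3` members over `τ` (`k`-signature `(2,3)` or `(3,2)`); `Hom(K_m, K_{m₀}) = ∅` whenever `m₀ ≠ m` and `n_{m₀} = n_m`.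
Then the Hodge conjecture holds for EVERY product of copies `⨁_j A(κ j)`.  `HC_CM` is NOT asserted. [cite: Markman2025SurveySecant, Thm. 1.2] [cite: Markman2025SecantWeil, Thm 1.5.1]
[cite: Deligne1982HodgeCycles, §5 (b)] [cite: Shimura1998, §8.2 Prop. 26 and §8.4] [cite: Dodson1984, §1.1 Imprimitivity Theorem and §5.1.2 Theorem] [cite: DixonMortimer1996, §3.3, Thm. 3.3A] -/
theorem hodgeConjectureFor_biproduct_comp_of_simpleThreefolds_weilFivefolds_of_isEmpty_ringHom (hW4 : Markman2025_weilClasses_algebraic_abelianFourfold)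
    (hM6 : Markman2025_weilClasses_algebraic_hyperbolicSixfold) (n : Fin r → ℕ) (hn : ∀ m, n m = 3 ∨ n m = 5)
    {N : ℕ} (κ : Fin N → Fin (r + 1)) (h2 : Module.finrank ℚ (Kf i₀) = 2) (hdeg : ∀ m : Fin r, Module.finrank ℚ (Kf (is m)) = 2 * n m)
    (im : ∀ m : Fin r, Kf i₀ →+* Kf (is m)) (hA : ∀ j, IsCMTypeRealisation (Φ j) (A j) (ι j) (θ j)) (hΨ : ∀ σ : Kf i₀ →+* ℂ, σ ∈ (Φ 0).1 ↔ σ = τ)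
    (hS : ∀ m : Fin r, n m = 3 → (A m.succ).IsSimple)
    (h23 : ∀ m : Fin r, n m = 5 → (Finset.univ.filter fun s : Kf (is m) →+* ℂ => s.comp (im m) = τ ∧ s ∈ (Φ m.succ).1).card = 2 ∨
      (Finset.univ.filter fun s : Kf (is m) →+* ℂ => s.comp (im m) = τ ∧ s ∈ (Φ m.succ).1).card = 3)
    (hiso : ∀ (m₀ m : Fin r), m₀ ≠ m → n m₀ = n m → IsEmpty (Kf (is m) →+* Kf (is m₀))) :
    HodgeConjectureFor (⨁ fun j => A (κ j)).dim (⨁ fun j => A (κ j)).X := by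
  -- the normalised counts `p m` with `(n m, p m) ∈ {(3,1), (5,2)}`
  have hex : ∀ m : Fin r, ∃ pm : ℕ, pm ≤ n m ∧ ((n m = 3 ∧ pm = 1) ∨ (n m = 5 ∧ pm = 2)) ∧
      ((Finset.univ.filter fun s : Kf (is m) →+* ℂ => s.comp (im m) = τ ∧ s ∈ (Φ m.succ).1).card = pm ∨
        (Finset.univ.filter fun s : Kf (is m) →+* ℂ => s.comp (im m) = τ ∧ s ∈ (Φ m.succ).1).card = n m - pm) := fun m => by
    rcases hn m with h | h
    · refine ⟨1, by rw [h]; norm_num, Or.inl ⟨h, rfl⟩, ?_⟩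
      rcases card_filter_mem_eq_one_or_two_of_isSimple (by rw [hdeg m, h]) h2 (im m) (hA m.succ) (hS m h) τ with hc | hc
      · exact Or.inl hc
      · exact Or.inr (hc.trans (by rw [h] : n m - 1 = 2).symm)
    · refine ⟨2, by rw [h]; norm_num, Or.inr ⟨h, rfl⟩, ?_⟩
      rcases h23 m h with hc | hc
      · exact Or.inl hc
      · exact Or.inr (by rw [hc, h])
  choose p hpn hnp hor using hex
  obtain ⟨Φ', ι', θ', hA', h0, hp⟩ := exists_realisations_card_eq_of_or (n := n) (Φ := Φ) h2 hdeg im hA p hpn hor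
  have hΨ' : ∀ σ : Kf i₀ →+* ℂ, σ ∈ (Φ' 0).1 ↔ σ = τ := by rw [h0]; exact hΨ
  exact hodgeConjectureFor_biproduct_comp_of_sexticsDecics_of_isEmpty_ringHom (Φ := Φ') hW4 hM6 n p hnp κ h2 hdeg im hA' hΨ' hp hiso

/-- **Dominated form.** [cite: Markman2025SurveySecant, Thm. 1.2] [cite: Markman2025SecantWeil, Thm 1.5.1] [cite: MumfordAV1970, §19] -/
theorem hodgeConjectureFor_of_avDominatedBy_comp_of_simpleThreefolds_weilFivefolds_of_isEmpty_ringHom (hW4 : Markman2025_weilClasses_algebraic_abelianFourfold)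
    (hM6 : Markman2025_weilClasses_algebraic_hyperbolicSixfold) (n : Fin r → ℕ) (hn : ∀ m, n m = 3 ∨ n m = 5)
    {N : ℕ} (κ : Fin N → Fin (r + 1)) (h2 : Module.finrank ℚ (Kf i₀) = 2) (hdeg : ∀ m : Fin r, Module.finrank ℚ (Kf (is m)) = 2 * n m)
    (im : ∀ m : Fin r, Kf i₀ →+* Kf (is m)) (hA : ∀ j, IsCMTypeRealisation (Φ j) (A j) (ι j) (θ j)) (hΨ : ∀ σ : Kf i₀ →+* ℂ, σ ∈ (Φ 0).1 ↔ σ = τ)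
    (hS : ∀ m : Fin r, n m = 3 → (A m.succ).IsSimple)
    (h23 : ∀ m : Fin r, n m = 5 → (Finset.univ.filter fun s : Kf (is m) →+* ℂ => s.comp (im m) = τ ∧ s ∈ (Φ m.succ).1).card = 2 ∨
      (Finset.univ.filter fun s : Kf (is m) →+* ℂ => s.comp (im m) = τ ∧ s ∈ (Φ m.succ).1).card = 3)
    (hiso : ∀ (m₀ m : Fin r), m₀ ≠ m → n m₀ = n m → IsEmpty (Kf (is m) →+* Kf (is m₀)))
    {X : AbelianVariety ℂ} (hX : Domination.AVDominatedBy X (⨁ fun j => A (κ j))) : HodgeConjectureFor X.dim X.X :=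
  Domination.hodgeConjectureFor_of_avDominatedBy
    (hodgeConjectureFor_biproduct_comp_of_simpleThreefolds_weilFivefolds_of_isEmpty_ringHom hW4 hM6 n hn κ h2 hdeg im hA hΨ hS h23 hiso) hX

/-- **SIMPLE CM THREEFOLDS, CM FOURFOLDS OF `k`-SIGNATURE `(1,3)`, `(2,2)` OR `(3,1)` OVER OCTIC FIELDS WITH `2`-TRANSITIVE QUARTIC PART, WEIL-TYPE CM FIVEFOLDS — GIVEN ONLY
MARKMAN'S TWO THEOREMS.**  `k = Kf i₀` imaginary quadratic, `E = A 0 ⊨ (k; {τ})`; `B_m = A (m+1) ⊨ (K_m; Φ (m+1))`, `[K_m : k] = n_m ∈ {3, 4, 5}`: `n_m = 3` ⟹ `B_m` SIMPLE;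
`n_m = 4` ⟹ the type has `1`, `2` OR `3` members over `τ` (every type not induced from `k`); `n_m = 5` ⟹ `2` OR `3` members over `τ`.  HYPOTHESES (Z3): (i) for octic `K_m` the
automorphisms of `ℂ` over `τ(k)` are `2`-transitive on its `τ`-embeddings; (ii) for `m₀ ≠ m` with `n_{m₀} = n_m`, and for `n_{m₀} = 4`, `n_m = 3`, some `τ`-embedding of `K_m`
takes some value outside `L(K_{m₀})`.  Then the Hodge conjecture holds for EVERY product of copies `⨁_j A(κ j)`.  `HC_CM` is NOT asserted. [cite: Markman2025SurveySecant, Thm. 1.2]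
[cite: Markman2025SecantWeil, Thm 1.5.1] [cite: Deligne1982HodgeCycles, §5 (b)] [cite: Shimura1998, §8.2 Prop. 26 and §8.4] [cite: DixonMortimer1996, §3.3, Thm. 3.3A] -/
theorem hodgeConjectureFor_biproduct_comp_of_simpleThreefolds_fourfolds_weilFivefolds (hW4 : Markman2025_weilClasses_algebraic_abelianFourfold)
    (hM6 : Markman2025_weilClasses_algebraic_hyperbolicSixfold) (n : Fin r → ℕ) (hn : ∀ m, n m = 3 ∨ n m = 4 ∨ n m = 5)
    {N : ℕ} (κ : Fin N → Fin (r + 1)) (h2 : Module.finrank ℚ (Kf i₀) = 2) (hdeg : ∀ m : Fin r, Module.finrank ℚ (Kf (is m)) = 2 * n m)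
    (im : ∀ m : Fin r, Kf i₀ →+* Kf (is m)) (hA : ∀ j, IsCMTypeRealisation (Φ j) (A j) (ι j) (θ j)) (hΨ : ∀ σ : Kf i₀ →+* ℂ, σ ∈ (Φ 0).1 ↔ σ = τ)
    (hS : ∀ m : Fin r, n m = 3 → (A m.succ).IsSimple)
    (h4 : ∀ m : Fin r, n m = 4 → (Finset.univ.filter fun s : Kf (is m) →+* ℂ => s.comp (im m) = τ ∧ s ∈ (Φ m.succ).1).card = 1 ∨
      (Finset.univ.filter fun s : Kf (is m) →+* ℂ => s.comp (im m) = τ ∧ s ∈ (Φ m.succ).1).card = 2 ∨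
      (Finset.univ.filter fun s : Kf (is m) →+* ℂ => s.comp (im m) = τ ∧ s ∈ (Φ m.succ).1).card = 3)
    (h23 : ∀ m : Fin r, n m = 5 → (Finset.univ.filter fun s : Kf (is m) →+* ℂ => s.comp (im m) = τ ∧ s ∈ (Φ m.succ).1).card = 2 ∨
      (Finset.univ.filter fun s : Kf (is m) →+* ℂ => s.comp (im m) = τ ∧ s ∈ (Φ m.succ).1).card = 3)
    (h2T : ∀ m : Fin r, n m = 4 → ∀ s₁ s₂ s₁' s₂' : Kf (is m) →+* ℂ, s₁.comp (im m) = τ → s₂.comp (im m) = τ → s₁'.comp (im m) = τ →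
      s₂'.comp (im m) = τ → s₁ ≠ s₂ → s₁' ≠ s₂' → ∃ ρ : ℂ ≃+* ℂ, (ρ : ℂ →+* ℂ).comp τ = τ ∧ (ρ : ℂ →+* ℂ).comp s₁ = s₁' ∧ (ρ : ℂ →+* ℂ).comp s₂ = s₂')
    (hout : ∀ (m₀ m : Fin r), m₀ ≠ m → (n m₀ = n m ∨ (n m₀ = 4 ∧ n m = 3)) →
      ∃ s : Kf (is m) →+* ℂ, s.comp (im m) = τ ∧ ∃ x, s x ∉ normalClosure ℚ (Kf (is m₀)) ℂ) :
    HodgeConjectureFor (⨁ fun j => A (κ j)).dim (⨁ fun j => A (κ j)).X := by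
  -- the normalised counts `p m` with `(n m, p m) ∈ {(3,1), (4,1), (4,2), (5,2)}`
  have hex : ∀ m : Fin r, ∃ pm : ℕ, pm ≤ n m ∧ ((n m = 3 ∧ pm = 1) ∨ (n m = 4 ∧ pm = 1) ∨ (n m = 4 ∧ pm = 2) ∨ (n m = 5 ∧ pm = 2)) ∧
      ((Finset.univ.filter fun s : Kf (is m) →+* ℂ => s.comp (im m) = τ ∧ s ∈ (Φ m.succ).1).card = pm ∨
        (Finset.univ.filter fun s : Kf (is m) →+* ℂ => s.comp (im m) = τ ∧ s ∈ (Φ m.succ).1).card = n m - pm) := fun m => by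
    rcases hn m with h | h | h
    · refine ⟨1, by rw [h]; norm_num, Or.inl ⟨h, rfl⟩, ?_⟩
      rcases card_filter_mem_eq_one_or_two_of_isSimple (by rw [hdeg m, h]) h2 (im m) (hA m.succ) (hS m h) τ with hc | hc
      · exact Or.inl hc
      · exact Or.inr (hc.trans (by rw [h] : n m - 1 = 2).symm)
    · rcases h4 m h with hc | hc | hc
      · exact ⟨1, by rw [h]; norm_num, Or.inr (Or.inl ⟨h, rfl⟩), Or.inl hc⟩
      · exact ⟨2, by rw [h]; norm_num, Or.inr (Or.inr (Or.inl ⟨h, rfl⟩)), Or.inl hc⟩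
      · exact ⟨1, by rw [h]; norm_num, Or.inr (Or.inl ⟨h, rfl⟩), Or.inr (by rw [hc, h])⟩
    · refine ⟨2, by rw [h]; norm_num, Or.inr (Or.inr (Or.inr ⟨h, rfl⟩)), ?_⟩
      rcases h23 m h with hc | hc
      · exact Or.inl hc
      · exact Or.inr (by rw [hc, h])
  choose p hpn hnp hor using hex
  obtain ⟨Φ', ι', θ', hA', h0, hp⟩ := exists_realisations_card_eq_of_or (n := n) (Φ := Φ) h2 hdeg im hA p hpn hor
  have hΨ' : ∀ σ : Kf i₀ →+* ℂ, σ ∈ (Φ' 0).1 ↔ σ = τ := by rw [h0]; exact hΨ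
  exact hodgeConjectureFor_biproduct_comp_of_sexticsOcticsDecics (Φ := Φ') hW4 hM6 n p hnp κ h2 hdeg im hA' hΨ' hp h2T hout

/-- **Dominated form.** [cite: Markman2025SurveySecant, Thm. 1.2] [cite: Markman2025SecantWeil, Thm 1.5.1] [cite: MumfordAV1970, §19] -/
theorem hodgeConjectureFor_of_avDominatedBy_comp_of_simpleThreefolds_fourfolds_weilFivefolds (hW4 : Markman2025_weilClasses_algebraic_abelianFourfold)
    (hM6 : Markman2025_weilClasses_algebraic_hyperbolicSixfold) (n : Fin r → ℕ) (hn : ∀ m, n m = 3 ∨ n m = 4 ∨ n m = 5)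
    {N : ℕ} (κ : Fin N → Fin (r + 1)) (h2 : Module.finrank ℚ (Kf i₀) = 2) (hdeg : ∀ m : Fin r, Module.finrank ℚ (Kf (is m)) = 2 * n m)
    (im : ∀ m : Fin r, Kf i₀ →+* Kf (is m)) (hA : ∀ j, IsCMTypeRealisation (Φ j) (A j) (ι j) (θ j)) (hΨ : ∀ σ : Kf i₀ →+* ℂ, σ ∈ (Φ 0).1 ↔ σ = τ)
    (hS : ∀ m : Fin r, n m = 3 → (A m.succ).IsSimple)
    (h4 : ∀ m : Fin r, n m = 4 → (Finset.univ.filter fun s : Kf (is m) →+* ℂ => s.comp (im m) = τ ∧ s ∈ (Φ m.succ).1).card = 1 ∨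
      (Finset.univ.filter fun s : Kf (is m) →+* ℂ => s.comp (im m) = τ ∧ s ∈ (Φ m.succ).1).card = 2 ∨
      (Finset.univ.filter fun s : Kf (is m) →+* ℂ => s.comp (im m) = τ ∧ s ∈ (Φ m.succ).1).card = 3)
    (h23 : ∀ m : Fin r, n m = 5 → (Finset.univ.filter fun s : Kf (is m) →+* ℂ => s.comp (im m) = τ ∧ s ∈ (Φ m.succ).1).card = 2 ∨
      (Finset.univ.filter fun s : Kf (is m) →+* ℂ => s.comp (im m) = τ ∧ s ∈ (Φ m.succ).1).card = 3)
    (h2T : ∀ m : Fin r, n m = 4 → ∀ s₁ s₂ s₁' s₂' : Kf (is m) →+* ℂ, s₁.comp (im m) = τ → s₂.comp (im m) = τ → s₁'.comp (im m) = τ →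
      s₂'.comp (im m) = τ → s₁ ≠ s₂ → s₁' ≠ s₂' → ∃ ρ : ℂ ≃+* ℂ, (ρ : ℂ →+* ℂ).comp τ = τ ∧ (ρ : ℂ →+* ℂ).comp s₁ = s₁' ∧ (ρ : ℂ →+* ℂ).comp s₂ = s₂')
    (hout : ∀ (m₀ m : Fin r), m₀ ≠ m → (n m₀ = n m ∨ (n m₀ = 4 ∧ n m = 3)) →
      ∃ s : Kf (is m) →+* ℂ, s.comp (im m) = τ ∧ ∃ x, s x ∉ normalClosure ℚ (Kf (is m₀)) ℂ)
    {X : AbelianVariety ℂ} (hX : Domination.AVDominatedBy X (⨁ fun j => A (κ j))) : HodgeConjectureFor X.dim X.X :=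
  Domination.hodgeConjectureFor_of_avDominatedBy
    (hodgeConjectureFor_biproduct_comp_of_simpleThreefolds_fourfolds_weilFivefolds hW4 hM6 n hn κ h2 hdeg im hA hΨ hS h4 h23 h2T hout) hX

end Headline

end Summit.HodgeConjecture.CorCM.MultiFieldWeil

end
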